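import Summits.RiemannHypothesis.RiemannHypothesis.Theses.NymanBeurling
import Summits.RiemannHypothesis.RiemannHypothesis.Theorems.NymanBeurlingNbThesisLowerBound
import Literature.Barriers.RiemannHypothesis.NymanBeurlingObstructionsBDBLSProofs

/-!
# RiemannHypothesis / NymanBeurling — dictionary: the route's integral is `2π ‖χ + Σ a_k ρ_{k+1}‖²`, and real coefficients suffice

Route `RiemannHypothesis/NymanBeurling`, crux #2 `NbRateLog` (item stmt-RiemannHypothesis-0394) and
the integrand shared by all items of the route,

  `I(a) := ∫⁻ ‖1 - ζ(1/2+it) Σ_{k<N} a_k (k+1)^{-(1/2+it)}‖² dt/(1/4+t²)`,   `a : Fin N → ℂ`.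

This file identifies `I(a)` EXACTLY with the function-space quantities of the barrier catalogue
`Literature/Barriers/RiemannHypothesis/NymanBeurlingObstructions.lean` (`genError`, `natError`,
Báez-Duarte's `‖χ - Σ c_k ρ_{a_k}‖_{L²(0,∞)}`), so that every result stated there transfers verbatim:

* `nb_lintegral_eq_ofReal_integral_normSq` — Mellin–Plancherel as an identity:
  `I(a) = ofReal (2π ∫_0^∞ ‖g_a‖²)` with `g_a = χ + Σ a_k ρ_{k+1}` (written through the tree's real
  approximants `nbFun`: `g_a = f_{-Re a} + i (f_0 - f_{Im a})`, `f_c = χ - Σ c_k ρ_{k+1}`);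
* `nb_lintegral_re_le` — **real coefficients suffice**: `I(Re a) ≤ I(a)` (`χ` and the `ρ_k` are
  real, so discarding `Im a` can only decrease the distance);
* `nb_lintegral_re_eq_natError` — for the real part, `I(Re a) = ofReal (2π) · natError N (-Re a)²`,
  literally `2π ‖χ - Σ_k (-Re a_k) ρ_{k+1}‖²_{L²(0,∞)}`;
* `nbRateLog_iff_natError` — hence crux #2 is, verbatim in Báez-Duarte's normalisation,
  `∃ C, ∀ N ≥ 2, ∃ c : Fin N → ℝ, 2π ‖χ - Σ_{k<N} c_k ρ_{k+1}‖² ≤ C / log N`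
  (i.e. `d_N² ≤ C/(2π log N)` with REAL coefficients), the form in which [BDBLS2000], [Burnol2002]
  and [BaezDuarte2003] work.

References: L. Báez-Duarte, Rend. Lincei 14 (2003) §2.2 (2.4) (Mellin transform of the
approximant); J.-F. Burnol, Adv. Math. 170 (2002) §3 (Mellin–Plancherel isometry); L. Báez-Duarte,
M. Balazard, B. Landreau, E. Saias, Adv. Math. 149 (2000).
-/

noncomputable section

open Complex MeasureTheory Set Filter
open scoped Real ENNReal

namespace Summit.RiemannHypothesis.RiemannHypothesis.Theorems

open Summit.RiemannHypothesis.RiemannHypothesis.Theses.NymanBeurling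
open Literature.NumberTheory.LFunctions Literature.NumberTheory.LFunctions.BaezDuarteU
open Literature.Barriers.RiemannHypothesis

/-- **Mellin–Plancherel identity for the route's integrand.** For every `N` and `a : Fin N → ℂ`,
`∫⁻ ‖1 - ζA‖²/(1/4+t²) = ofReal (2π ∫_0^∞ ‖g_a‖²)`, where
`g_a = f_{-Re a} + i(f_0 - f_{Im a})` (`f_c = nbFun (k ↦ k+1) c = χ - Σ c_k ρ_{k+1}`) is the
complex combination `χ + Σ a_k ρ_{k+1}`, whose Mellin transform on the critical line is
`(1 - ζ(s)A(s))/s` (`hasMellin_nbComplexApprox`). [cite: Burnol2002, §3] [cite: BaezDuarte2003, §2.2 (2.4)] -/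
theorem nb_lintegral_eq_ofReal_integral_normSq (N : ℕ) (a : Fin N → ℂ) :
    ∫⁻ t : ℝ, ENNReal.ofReal (‖1 - riemannZeta (1 / 2 + t * Complex.I) *
        ∑ n : Fin N, a n * ((n : ℂ) + 1) ^ (-(1 / 2 + t * Complex.I))‖ ^ 2 / (1 / 4 + t ^ 2)) =
      ENNReal.ofReal (2 * π * ∫ t in Ioi (0 : ℝ),
        ‖nbFun (fun k : Fin N ↦ ((k : ℕ) : ℝ) + 1) (fun j ↦ -(a j).re) t +
          I * (nbFun (fun k : Fin N ↦ ((k : ℕ) : ℝ) + 1) (fun _ ↦ (0 : ℝ)) t -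
            nbFun (fun k : Fin N ↦ ((k : ℕ) : ℝ) + 1) (fun j ↦ (a j).im) t)‖ ^ 2) := by
  set d : Fin N → ℝ := fun k ↦ ((k : ℕ) : ℝ) + 1 with hd
  have hd1 : ∀ j, 1 ≤ d j := fun j ↦ (natDilation_le_max N j).1
  set x : Fin N → ℝ := fun j ↦ -(a j).re with hx
  set y : Fin N → ℝ := fun j ↦ (a j).im with hy
  set g : ℝ → ℂ := fun t ↦ nbFun d x t + I * (nbFun d (fun _ ↦ (0 : ℝ)) t - nbFun d y t) with hg
  have hgL2 : MemLp g 2 (volume.restrict (Ioi (0 : ℝ))) :=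
    (memLp_two_nbFun d x hd1).add
      (((memLp_two_nbFun d _ hd1).sub (memLp_two_nbFun d y hd1)).const_mul I)
  have hg2 : IntegrableOn (fun t ↦ ‖g t‖ ^ 2) (Ioi 0) :=
    (memLp_two_iff_integrable_sq_norm hgL2.1).1 hgL2
  have hgM : MellinConvergent g (1 / 2) :=
    (hasMellin_nbComplexApprox a (s := 1 / 2) (by norm_num) (by norm_num)).1
  obtain ⟨hint, hP⟩ := Literature.Analysis.FunctionSpaces.integral_norm_sq_mellin_half_eq hgM hg2
  have hpt : ∀ t : ℝ, ‖1 - riemannZeta (1 / 2 + t * Complex.I) *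
      ∑ n : Fin N, a n * ((n : ℂ) + 1) ^ (-(1 / 2 + t * Complex.I))‖ ^ 2 / (1 / 4 + t ^ 2) =
      ‖mellin g (1 / 2 + t * I)‖ ^ 2 := by
    intro t
    rw [(hasMellin_nbComplexApprox a (s := 1 / 2 + t * I) (by simp) (by simp; norm_num)).2,
      norm_div, div_pow, norm_sq_one_half_add]
  calc ∫⁻ t : ℝ, ENNReal.ofReal (‖1 - riemannZeta (1 / 2 + t * Complex.I) *
        ∑ n : Fin N, a n * ((n : ℂ) + 1) ^ (-(1 / 2 + t * Complex.I))‖ ^ 2 / (1 / 4 + t ^ 2))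
      = ∫⁻ τ : ℝ, ENNReal.ofReal (‖mellin g (1 / 2 + τ * I)‖ ^ 2) :=
        lintegral_congr fun t ↦ by rw [hpt t]
    _ = ENNReal.ofReal (∫ τ : ℝ, ‖mellin g (1 / 2 + τ * I)‖ ^ 2) :=
        (ofReal_integral_eq_lintegral_ofReal hint (Eventually.of_forall fun _ ↦ by positivity)).symm
    _ = ENNReal.ofReal (2 * π * ∫ t in Ioi (0 : ℝ), ‖g t‖ ^ 2) := by rw [hP]
    _ = _ := by simp only [hg]

/-- **Real coefficients suffice.** Replacing the coefficients by their real parts never increases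
the route's integral: `∫⁻ ‖1 - ζ·(Σ (Re a_k)(k+1)^{-s})‖²/(1/4+t²) ≤ ∫⁻ ‖1 - ζA‖²/(1/4+t²)`
(`χ` and the `ρ_k` are real-valued, so `‖Re g_a‖ ≤ ‖g_a‖` pointwise). In particular infima,
witnesses and optimal polynomials may be taken with real coefficients. [cite: BaezDuarte2003, §1] -/
theorem nb_lintegral_re_le (N : ℕ) (a : Fin N → ℂ) :
    ∫⁻ t : ℝ, ENNReal.ofReal (‖1 - riemannZeta (1 / 2 + t * Complex.I) *
        ∑ n : Fin N, ((a n).re : ℂ) * ((n : ℂ) + 1) ^ (-(1 / 2 + t * Complex.I))‖ ^ 2 / (1 / 4 + t ^ 2)) ≤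
      ∫⁻ t : ℝ, ENNReal.ofReal (‖1 - riemannZeta (1 / 2 + t * Complex.I) *
        ∑ n : Fin N, a n * ((n : ℂ) + 1) ^ (-(1 / 2 + t * Complex.I))‖ ^ 2 / (1 / 4 + t ^ 2)) := by
  rw [nb_lintegral_eq_ofReal_integral_normSq N (fun n ↦ ((a n).re : ℂ)),
    nb_lintegral_eq_ofReal_integral_normSq N a]
  simp only [Complex.ofReal_re, Complex.ofReal_im, sub_self, mul_zero, add_zero]
  set d : Fin N → ℝ := fun k ↦ ((k : ℕ) : ℝ) + 1 with hd
  have hd1 : ∀ j, 1 ≤ d j := fun j ↦ (natDilation_le_max N j).1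
  refine ENNReal.ofReal_le_ofReal (mul_le_mul_of_nonneg_left ?_ (by positivity))
  have hgL2 : MemLp (fun t ↦ nbFun d (fun j ↦ -(a j).re) t +
      I * (nbFun d (fun _ ↦ (0 : ℝ)) t - nbFun d (fun j ↦ (a j).im) t)) 2
      (volume.restrict (Ioi (0 : ℝ))) :=
    (memLp_two_nbFun d _ hd1).add
      (((memLp_two_nbFun d _ hd1).sub (memLp_two_nbFun d _ hd1)).const_mul I)
  refine integral_mono (integrableOn_norm_sq_nbFun d _ hd1)
    ((memLp_two_iff_integrable_sq_norm hgL2.1).1 hgL2) fun t ↦ ?_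
  exact norm_sq_ofReal_le _ _ _

/-- **The real-coefficient integral is Báez-Duarte's distance.** For every `a : Fin N → ℂ`,
`∫⁻ ‖1 - ζ·(Σ (Re a_k)(k+1)^{-s})‖²/(1/4+t²) = ofReal (2π) · natError N (-Re a)²`, where
`natError N c = ‖χ - Σ_{k<N} c_k ρ_{k+1}‖_{L²(0,∞)}` is the quantity of the barrier catalogue
(`Literature.Barriers.RiemannHypothesis.natError`) and of `Literature.NumberTheory.LFunctions.baezDuarte_iff`.
[cite: BaezDuarte2003, §1 (1.3) and §2.2 (2.4)] -/
theorem nb_lintegral_re_eq_natError (N : ℕ) (a : Fin N → ℂ) :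
    ∫⁻ t : ℝ, ENNReal.ofReal (‖1 - riemannZeta (1 / 2 + t * Complex.I) *
        ∑ n : Fin N, ((a n).re : ℂ) * ((n : ℂ) + 1) ^ (-(1 / 2 + t * Complex.I))‖ ^ 2 / (1 / 4 + t ^ 2)) =
      ENNReal.ofReal (2 * π) * natError N (fun j ↦ -(a j).re) ^ 2 := by
  rw [nb_lintegral_eq_ofReal_integral_normSq N (fun n ↦ ((a n).re : ℂ))]
  simp only [Complex.ofReal_re, Complex.ofReal_im, sub_self, mul_zero, add_zero]
  have hd1 : ∀ j : Fin N, (1 : ℝ) ≤ ((j : ℕ) : ℝ) + 1 := fun j ↦ (natDilation_le_max N j).1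
  have hI0 : 0 ≤ ∫ t in Ioi (0 : ℝ),
      ‖nbFun (fun k : Fin N ↦ ((k : ℕ) : ℝ) + 1) (fun j ↦ -(a j).re) t‖ ^ 2 :=
    integral_nonneg fun _ ↦ by positivity
  rw [natError, BDBLS2000.genError_eq _ _ hd1, ← ENNReal.ofReal_pow (Real.sqrt_nonneg _),
    Real.sq_sqrt hI0, ← ENNReal.ofReal_mul (by positivity)]

/-- **Crux #2 in Báez-Duarte's normalisation.** `NbRateLog` holds iff one constant `C` gives, for
every `N ≥ 2`, REAL coefficients `c` with `2π ‖χ - Σ_{k<N} c_k ρ_{k+1}‖²_{L²(0,∞)} ≤ C / log N`,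
i.e. `d_N² ≤ C/(2π log N)` in the notation of [BDBLS2000; BettinConreyFarmer2013].
(`→`: pass to real parts, `nb_lintegral_re_le`; `←`: embed real coefficients.) [cite: BaezDuarte2003, Thm. 1.1] -/
theorem nbRateLog_iff_natError :
    NbRateLog ↔ ∃ C : ℝ, ∀ N : ℕ, 2 ≤ N → ∃ c : Fin N → ℝ,
      ENNReal.ofReal (2 * π) * natError N c ^ 2 ≤ ENNReal.ofReal (C / Real.log N) := by
  unfold NbRateLog
  constructor
  · rintro ⟨C, hC⟩
    refine ⟨C, fun N hN ↦ ?_⟩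
    obtain ⟨a, ha⟩ := hC N hN
    refine ⟨fun j ↦ -(a j).re, ?_⟩
    rw [← nb_lintegral_re_eq_natError N a]
    exact (nb_lintegral_re_le N a).trans ha
  · rintro ⟨C, hC⟩
    refine ⟨C, fun N hN ↦ ?_⟩
    obtain ⟨c, hc⟩ := hC N hN
    refine ⟨fun j ↦ ((-c j : ℝ) : ℂ), ?_⟩
    have h := nb_lintegral_re_eq_natError N (fun j ↦ ((-c j : ℝ) : ℂ))
    simp only [Complex.ofReal_re, neg_neg] at h
    rw [h]
    exact hc

end Summit.RiemannHypothesis.RiemannHypothesis.Theorems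

end
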